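import Summits.QuantumFields.YangMills.Theorems.BalabanUVNodesN15KingModelSourceResponseThermodynamicLimit
import Summits.QuantumFields.YangMills.Theorems.BalabanUVNodesN15KingModelGaussianIntegrationByParts

/-!
# BalabanUVNodes ∕ N15 — THE KING-MODEL RUNG (PART Ϸ-h): THE ONE-POINT FUNCTION IN AN EXTERNAL SOURCE — `⟨x_s⟩_h := ∫x_s e^{⟨h,x⟩}ρ_A ∕ ∫e^{⟨h,x⟩}ρ_A = (A⁻¹h)_s`
# (Gaussian shift), KING: `⟨φ(s)⟩_{h,Ω} = Σ_w S₂^{(∞)}_Ω(s,w)h(w)`, and its THERMODYNAMIC LIMIT `⟨φ(0)⟩_{h,Ω_k} → Σ_z S₂^{ℝ}(z)h(z)` for every bounded source `h` on `ℤ^{d+1}`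
# (Track A, DAG node N15 = NE2; FAN-OUT v1.1 §N15 s3 «KING-MODEL RUNG»; uses parts Ͱ-a (translation identity), Ϝ-s (mean zero, integrability), Ϝ-r∕Ϝ-s (`fineBlockPrecLim`,
# `fineBlockPrecLim_inv`), Ϸ-g (the response limit); count-neutral)

HONEST FRAMING.  Count-neutral (cell `pub-ymgap`, seat `pub-ymgap-dag-n15-e` g34; `--supports stmt-QuantumFields-27366 --as helper` = K3⁸
`SpineGivenEndpointR13SepCoPHV`).  King's `A = 0`, `g = 0` model ([King1986] C. King, Commun. Math. Phys. **102** (1986) 649–677; the source term `⟨h,ψ⟩` of the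
generating functional (2.4)–(2.6)).  For the density-defined Gaussian law `ρ_A dx` (symmetric coercive `A`) the one-point function in the external source `h` —
the normalised tilted mean `∫x_s e^{⟨h,x⟩}ρ_A(x)dx ∕ ∫e^{⟨h,x⟩}ρ_A(x)dx` — equals `(A⁻¹h)_s` (part Ͱ-a's completing-the-square translation `x = y + A⁻¹h`, the centred mean
vanishes).  For King's `K = ∞` block field on the unit torus `Ω` (precision `P_∞ = (S₂^{(∞)})⁻¹`, part Ϝ-r) this reads `⟨φ(s)⟩_{h,Ω} = Σ_{w∈Ω}S₂^{(∞)}_Ω(s,w)h(w)` — the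
linear response IS the source-smeared two-point function — and part Ϸ-g's Tannery passage gives the thermodynamic limit of the one-point function at the origin in a
bounded source `h : ℤ^{d+1} → ℝ` read on `Ω_k` through centred representatives: `⟨φ(0)⟩_{h,Ω_k} → Σ_z S₂^{ℝ}(z)h(z)`.  NOT a node discharge (N15 is booked through
n15-a's knit, untouched here); nothing Bałaban ∕ continuum-Yang–Mills ∕ `ℝ⁴` ∕ OS ∕ Clay.  0 `sorry`, 0 def; standard axioms.

WHAT THIS FILE PROVES (kernel).  §1 generic: ★ `integral_dot_mul_exp_dot_gaussDensity` (`∫⟨J,x⟩e^{⟨w,x⟩}ρ_A = e^{½⟨w,A⁻¹w⟩}⟨J,A⁻¹w⟩`), ★★ **`onePoint_in_source_gaussDensity`**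
(`∫x_se^{⟨h,x⟩}ρ_A ∕ ∫e^{⟨h,x⟩}ρ_A = (A⁻¹h)_s`); §2 KING: ★★ **`onePoint_in_source_fineBlockLawLim`** (`= Σ_w S₂^{(∞)}_Ω(s,w)h(w)`), ★★★ **`tendsto_onePoint_in_source_volume`**
(`⟨φ(0)⟩_{h∘rep,Ω_k} → Σ_z S₂^{ℝ}(z)h(z)` along any tori with all periods `→ ∞`, every bounded `h`).

HONEST SCOPE.  King's free model; `K = ∞` block field; bounded sources.  N15 untouched; counts unmoved.  Locators (use): [King1986] (2.4)–(2.6) p.652, Thm 2.1 (2.22)–(2.23)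
p.654.
-/

noncomputable section

open scoped BigOperators Topology
open Finset Matrix Filter MeasureTheory

namespace Summit.QuantumFields.YangMills.BalabanUVNodes.N15KingModelRung.FreeField

open Literature.MathematicalPhysics.QuantumFieldTheory.Balaban1983to89.QGQInverse (Coercive isUnit_of_coercive)

/-! ## §1 Generic: the tilted mean of a Gaussian law -/

section Generic

variable {ι : Type*} [Fintype ι] [DecidableEq ι] {A : Matrix ι ι ℝ} {δ : ℝ}

/-- ★ **The tilted first moment**: `∫⟨J,x⟩e^{⟨w,x⟩}ρ_A(x)dx = e^{½⟨w,A⁻¹w⟩}·⟨J,A⁻¹w⟩` (translate `x = y + A⁻¹w`; the centred mean vanishes, `∫ρ_A = 1`). [cite: King1986, (2.6) p.652] -/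
theorem integral_dot_mul_exp_dot_gaussDensity (hδ : 0 < δ) (hA : Coercive A δ) (hsymm : Aᵀ = A) (J w : ι → ℝ) :
    ∫ x : ι → ℝ, (J ⬝ᵥ x) * Real.exp (w ⬝ᵥ x) * gaussDensity A x
      = Real.exp ((1 / 2 : ℝ) * (w ⬝ᵥ (A⁻¹ *ᵥ w))) * (J ⬝ᵥ (A⁻¹ *ᵥ w)) := by
  rw [integral_mul_exp_dot_gaussDensity_eq_transl hδ hA hsymm (fun x => J ⬝ᵥ x) w]
  congr 1
  have hint : Integrable fun y : ι → ℝ => (J ⬝ᵥ y) * gaussDensity A y := by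
    have h := integrable_pow_mul_exp_mul_gaussDensity hδ hA J 1 0
    refine h.congr (Eventually.of_forall fun y => ?_)
    simp only [pow_one, zero_mul, Real.exp_zero, mul_one]
  have e : (fun y : ι → ℝ => (J ⬝ᵥ (y + A⁻¹ *ᵥ w)) * gaussDensity A y)
      = fun y => (J ⬝ᵥ y) * gaussDensity A y + (J ⬝ᵥ (A⁻¹ *ᵥ w)) * gaussDensity A y := by
    funext y
    rw [dotProduct_add]
    ring
  have hint2 : Integrable fun y : ι → ℝ => (J ⬝ᵥ (A⁻¹ *ᵥ w)) * gaussDensity A y := (integrable_gaussDensity hδ hA).const_mul _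
  rw [e, integral_add hint hint2, integral_const_mul, integral_dot_gaussDensity hδ hA hsymm J, integral_gaussDensity_eq_one hδ hA]
  ring

/-- ★★ **THE ONE-POINT FUNCTION IN THE SOURCE `h`**: `∫x_s e^{⟨h,x⟩}ρ_A(x)dx ∕ ∫e^{⟨h,x⟩}ρ_A(x)dx = (A⁻¹h)_s` — the mean of the tilted Gaussian law is the covariance
applied to the source. [cite: King1986, (2.4)–(2.6) p.652] -/
theorem onePoint_in_source_gaussDensity (hδ : 0 < δ) (hA : Coercive A δ) (hsymm : Aᵀ = A) (h : ι → ℝ) (s : ι) :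
    (∫ x : ι → ℝ, x s * Real.exp (h ⬝ᵥ x) * gaussDensity A x) / (∫ x : ι → ℝ, Real.exp (h ⬝ᵥ x) * gaussDensity A x) = (A⁻¹ *ᵥ h) s := by
  have hZ : ∫ x : ι → ℝ, Real.exp (h ⬝ᵥ x) * gaussDensity A x = Real.exp ((1 / 2 : ℝ) * (h ⬝ᵥ (A⁻¹ *ᵥ h))) :=
    integral_exp_dot_gaussDensity hδ hA hsymm h
  have hN := integral_dot_mul_exp_dot_gaussDensity hδ hA hsymm (Pi.single s 1) h
  simp only [single_one_dotProduct] at hN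
  rw [hN, hZ, mul_div_cancel_left₀ _ (Real.exp_pos _).ne']

end Generic

end Summit.QuantumFields.YangMills.BalabanUVNodes.N15KingModelRung.FreeField

/-! ## §2 KING: the one-point function of the `K = ∞` block field in a source, and its thermodynamic limit -/

namespace Summit.QuantumFields.YangMills.BalabanUVNodes.N15KingModelRung

open Literature.MathematicalPhysics.QuantumFieldTheory.Balaban1983to89.B5Prop11Plancherel (Tor)
open Literature.MathematicalPhysics.QuantumFieldTheory.Balaban1983to89.QGQInverse (Coercive isUnit_of_coercive)
open FreeField

section King

variable {d : ℕ} (L : ℕ) (M : Fin (d + 1) → ℕ) [hM : ∀ ν, NeZero (M ν)]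

/-- ★★ **KING: `⟨φ(s)⟩_{h,Ω} = Σ_{w∈Ω}S₂^{(∞)}_Ω(s,w)h(w)`** — the one-point function of the `K = ∞` block field in the source `h` is the source-smeared block two-point
function (`P_∞⁻¹ = S₂^{(∞)}`). [cite: King1986, (2.4)–(2.6) p.652, Thm 2.1 (2.22)–(2.23) p.654] -/
theorem onePoint_in_source_fineBlockLawLim (hLodd : Odd L) (hL : 2 ≤ L) {m2 : ℝ} (hm : 0 < m2) (h : Tor M → ℝ) (s : Tor M) :
    (∫ φ : Tor M → ℝ, φ s * Real.exp (h ⬝ᵥ φ) * gaussDensity (fineBlockPrecLim M m2) φ)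
        / (∫ φ : Tor M → ℝ, Real.exp (h ⬝ᵥ φ) * gaussDensity (fineBlockPrecLim M m2) φ)
      = ∑ w, kingS2Lim M m2 s w * h w := by
  rw [onePoint_in_source_gaussDensity hm (coercive_fineBlockPrecLim L M hLodd hL hm) (fineBlockPrecLim_transpose M m2) h s,
    fineBlockPrecLim_inv L M hLodd hL hm]
  simp only [Matrix.mulVec, dotProduct, Matrix.of_apply]

end King

/-- ★★★ **THE THERMODYNAMIC LIMIT OF THE ONE-POINT FUNCTION IN A BOUNDED SOURCE**: for `h : ℤ^{d+1} → ℝ` with `|h| ≤ B`, read on `Ω_k` as `h∘rep`, and ANY tori with all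
periods `→ ∞`: `⟨φ(0)⟩_{h∘rep,Ω_k} → Σ_{z∈ℤ^{d+1}}S₂^{ℝ}(z)h(z)`. [cite: King1986, Thm 2.1 (2.22)–(2.23) p.654] -/
theorem tendsto_onePoint_in_source_volume {d : ℕ} {m2 : ℝ} (hm : 0 < m2) (Mseq : ℕ → Fin (d + 1) → ℕ) (hpos : ∀ k ν, 0 < Mseq k ν)
    (hlim : ∀ ν, Tendsto (fun k => (Mseq k ν : ℝ)) atTop atTop) {h : (Fin (d + 1) → ℤ) → ℝ} {B : ℝ} (hB : ∀ z, |h z| ≤ B) :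
    Tendsto (fun k => haveI : ∀ ν, NeZero (Mseq k ν) := fun ν => ⟨(hpos k ν).ne'⟩
      (∫ φ : Tor (Mseq k) → ℝ, φ 0 * Real.exp ((h ∘ torRep (Mseq k)) ⬝ᵥ φ) * gaussDensity (fineBlockPrecLim (Mseq k) m2) φ)
        / (∫ φ : Tor (Mseq k) → ℝ, Real.exp ((h ∘ torRep (Mseq k)) ⬝ᵥ φ) * gaussDensity (fineBlockPrecLim (Mseq k) m2) φ)) atTop
      (𝓝 (∑' z : Fin (d + 1) → ℤ, kingS2Inf m2 z * h z)) := by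
  have hL : 2 ≤ 3 := by norm_num
  have hLodd : Odd 3 := by decide
  refine (tendsto_sum_kingS2Lim_mul_volume hm Mseq hpos hlim hB).congr fun k => ?_
  haveI : ∀ ν, NeZero (Mseq k ν) := fun ν => ⟨(hpos k ν).ne'⟩
  rw [onePoint_in_source_fineBlockLawLim 3 (Mseq k) hLodd hL hm (h ∘ torRep (Mseq k)) 0]
  rfl

end Summit.QuantumFields.YangMills.BalabanUVNodes.N15KingModelRung
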